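import Summits.Ventures.PercRepro.HyperplaneKey
import Summits.Ventures.PercRepro.S1EightSixRankFiveNine

/-!
# PercRepro — THE HYPERPLANE BLOCK FOR THE LEVEL LPs: `#{spanning k-sets} ≤ C(n,k) − C(⌊(n−1)/2⌋,k) − C(⌈(n−1)/2⌉,k)` (p1, gen 42; S2 feeder for p2's LP)

In an `e`-free matroid the two parts `A ⊔ B = E ∖ {e}` at any point are both non-spanning, so their `k`-subsets (`k ≥ 1`)
are distinct non-spanning `k`-sets: `#{non-spanning k-sets} ≥ C(|A|, k) + C(|B|, k) ≥ C(⌊(n−1)/2⌋, k) + C(⌈(n−1)/2⌉, k)` (the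
balanced split minimises, by the discrete convexity `C(a,k) + C(b,k) ≥ C(a+1,k) + C(b−1,k)` for `a + 1 ≤ b`). In p2's LP
vocabulary (`S1.rkSets M k p` = the `k`-sets of rank `p`): **`#rkSets k p + C(⌊(n−1)/2⌋, k) + C(⌈(n−1)/2⌉, k) ≤ C(n, k)`**
(`ncard_rkSets_top_add_choose_le`). With it, p2's level-5 LP closes the cells `(8,42)`, `(8,43)`, `(10,47)`, `(11,45)` beyond its band
(exact certificates, kit j306168; lane lean-drafts/p1/g42/work/lp). Nothing about any cell is claimed here.

* `choose_add_choose_succ_le` — the convexity step; `choose_add_choose_balanced_le` — the balanced split minimises;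
* `ncard_rkSets_top_add_choose_le` — the block row.
Axioms: standard.
-/

open scoped Matroid

namespace PercRepro

namespace HypKey

open Set

variable {α : Type}

/-- `C(a+1, k) + C(b−1, k) ≤ C(a, k) + C(b, k)` for `a + 1 ≤ b` (Pascal on both sides, `C(a, k−1) ≤ C(b−1, k−1)`). -/
theorem choose_add_choose_succ_le (a b k : ℕ) (hab : a + 1 ≤ b) :
    (a + 1).choose k + (b - 1).choose k ≤ a.choose k + b.choose k := by
  rcases k with _ | k
  · simp
  obtain ⟨b', rfl⟩ : ∃ b', b = b' + 1 := ⟨b - 1, by omega⟩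
  show (a + 1).choose (k + 1) + (b' + 1 - 1).choose (k + 1) ≤ a.choose (k + 1) + (b' + 1).choose (k + 1)
  rw [Nat.add_sub_cancel, Nat.choose_succ_succ' a k, Nat.choose_succ_succ' b' k]
  have : a.choose k ≤ b'.choose k := Nat.choose_le_choose k (by omega)
  omega

/-- **The balanced split minimises `C(a, k) + C(s − a, k)`**: `C(⌊s/2⌋, k) + C(s − ⌊s/2⌋, k) ≤ C(a, k) + C(s − a, k)` for `a ≤ s`. -/
theorem choose_add_choose_balanced_le (k s : ℕ) : ∀ a, a ≤ s →
    (s / 2).choose k + (s - s / 2).choose k ≤ a.choose k + (s - a).choose k := by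
  -- first for a ≤ s/2, by induction on s/2 − a
  have left : ∀ m a, a + m = s / 2 → (s / 2).choose k + (s - s / 2).choose k ≤ a.choose k + (s - a).choose k := by
    intro m
    induction m with
    | zero => intro a ha; rw [show a = s / 2 by omega]
    | succ m ih =>
      intro a ha
      have h1 := ih (a + 1) (by omega)
      have h2 : (a + 1).choose k + (s - a - 1).choose k ≤ a.choose k + (s - a).choose k :=
        choose_add_choose_succ_le a (s - a) k (by omega)
      have h3 : s - (a + 1) = s - a - 1 := by omega
      rw [h3] at h1
      omega
  intro a ha
  rcases Nat.lt_or_ge (s / 2) a with hgt | hle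
  · -- a > s/2: use the symmetric point s − a ≤ s/2
    have h := left (s / 2 - (s - a)) (s - a) (by omega)
    rw [show s - (s - a) = a by omega] at h
    omega
  · exact left (s / 2 - a) a (by omega)

/-- **THE HYPERPLANE BLOCK ROW.** In an `e`-free matroid of rank `p` on `n ≥ 1` points, for every `k ≥ 1`:
`#{k-sets of rank p} + C(⌊(n−1)/2⌋, k) + C(⌈(n−1)/2⌉, k) ≤ C(n, k)`. -/
theorem ncard_rkSets_top_add_choose_le (M : Matroid α) [M.Finite] (p : ℕ) (hR : M.eRank = (p : ℕ∞))
    (hfree : ∀ e ∈ M.E, ∃ A ⊆ M.E \ {e}, e ∉ M.closure A ∧ e ∉ M.closure ((M.E \ {e}) \ A))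
    (hne : M.E.Nonempty) (k : ℕ) (hk : 1 ≤ k) :
    (S1.rkSets M k p).ncard + ((M.E.ncard - 1) / 2).choose k + (M.E.ncard - 1 - (M.E.ncard - 1) / 2).choose k ≤
      M.E.ncard.choose k := by
  obtain ⟨e, he⟩ := hne
  obtain ⟨A, hA, heA, heB⟩ := hfree e he
  have hEfin : M.E.Finite := M.ground_finite
  have hAE : A ⊆ M.E := hA.trans sdiff_subset
  have hBE : (M.E \ {e}) \ A ⊆ M.E := sdiff_subset.trans sdiff_subset
  have hAfin : A.Finite := hEfin.subset hAE
  have hBfin : ((M.E \ {e}) \ A).Finite := hEfin.subset hBE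
  have hArk : M.eRk A < M.eRank := eRk_lt_eRank_of_notMem_closure M hAE he heA
  have hBrk : M.eRk ((M.E \ {e}) \ A) < M.eRank := eRk_lt_eRank_of_notMem_closure M hBE he heB
  -- sizes: |A| + |B| = n − 1
  have h1 : (M.E \ {e}).ncard + 1 = M.E.ncard := ncard_sdiff_singleton_add_one he hEfin
  have h2 : ((M.E \ {e}) \ A).ncard + A.ncard = (M.E \ {e}).ncard :=
    ncard_sdiff_add_ncard_of_subset hA (hEfin.sdiff)
  -- the three families of k-sets
  set T := S1.rkSets M k p with hT
  set FA := {X : Set α | X ⊆ A ∧ X.ncard = k} with hFA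
  set FB := {X : Set α | X ⊆ (M.E \ {e}) \ A ∧ X.ncard = k} with hFB
  have hTfin : T.Finite := S1.rkSets_finite k p
  have hFAfin : FA.Finite := hAfin.finite_subsets.subset (fun X hX => hX.1)
  have hFBfin : FB.Finite := hBfin.finite_subsets.subset (fun X hX => hX.1)
  have hFAcard : FA.ncard = A.ncard.choose k := ncard_powerset_ncard hAfin k
  have hFBcard : FB.ncard = ((M.E \ {e}) \ A).ncard.choose k := ncard_powerset_ncard hBfin k
  -- disjointness
  have hTA : Disjoint T FA := by
    rw [Set.disjoint_left]
    rintro X ⟨-, -, hXr⟩ ⟨hXA, -⟩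
    have : M.eRk X < (p : ℕ∞) := by
      calc M.eRk X ≤ M.eRk A := M.eRk_mono hXA
        _ < M.eRank := hArk
        _ = (p : ℕ∞) := hR
    rw [hXr] at this
    exact lt_irrefl _ this
  have hTB : Disjoint T FB := by
    rw [Set.disjoint_left]
    rintro X ⟨-, -, hXr⟩ ⟨hXB, -⟩
    have : M.eRk X < (p : ℕ∞) := by
      calc M.eRk X ≤ M.eRk ((M.E \ {e}) \ A) := M.eRk_mono hXB
        _ < M.eRank := hBrk
        _ = (p : ℕ∞) := hR
    rw [hXr] at this
    exact lt_irrefl _ this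
  have hAB : Disjoint FA FB := by
    rw [Set.disjoint_left]
    rintro X ⟨hXA, hXk⟩ ⟨hXB, -⟩
    have hXne : X.Nonempty := by
      rw [← ncard_pos (hAfin.subset hXA)]
      omega
    obtain ⟨x, hx⟩ := hXne
    exact (hXB hx).2 (hXA hx)
  -- the union sits inside the k-subsets of E
  have hsub : T ∪ (FA ∪ FB) ⊆ {X : Set α | X ⊆ M.E ∧ X.ncard = k} := by
    rintro X (⟨hXE, hXk, -⟩ | (⟨hXA, hXk⟩ | ⟨hXB, hXk⟩))
    · exact ⟨hXE, hXk⟩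
    · exact ⟨hXA.trans hAE, hXk⟩
    · exact ⟨hXB.trans hBE, hXk⟩
  have hcard : (T ∪ (FA ∪ FB)).ncard = T.ncard + (FA.ncard + FB.ncard) := by
    rw [ncard_union_eq (Set.disjoint_union_right.2 ⟨hTA, hTB⟩) hTfin (hFAfin.union hFBfin),
      ncard_union_eq hAB hFAfin hFBfin]
  have hle : (T ∪ (FA ∪ FB)).ncard ≤ M.E.ncard.choose k := by
    rw [← ncard_powerset_ncard hEfin k]
    exact ncard_le_ncard hsub (hEfin.finite_subsets.subset (fun X hX => hX.1))
  -- the balanced split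
  have hbal := choose_add_choose_balanced_le k (M.E.ncard - 1) A.ncard (by omega)
  have hBA : M.E.ncard - 1 - A.ncard = ((M.E \ {e}) \ A).ncard := by omega
  rw [hBA] at hbal
  rw [hcard, hFAcard, hFBcard] at hle
  omega

end HypKey

end PercRepro
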